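import Summits.Ventures.PercRepro.C025ProfileTwoFlatPLD
import Summits.Ventures.PercRepro.C025ProfileOneFlatRowsArith

/-!
# PER-LAYER DOMINANCE ON TWO UNIFORM FLATS — THE ARITHMETIC FORM (night-3 g27)

`proofs/NIGHT3-G27-PLD.md` §2 and §5.  From the residual injection `card_RS_le_card_THI` of `C025ProfileTwoFlatPLD` to
a pure inequality between binomial sums: (1) the pairs `(I, D)` with `ρ(E ∖ I) ≤ hi + δ` are their own slots, so
per-layer dominance in source coordinates (`card_sources_le_card_T`) follows from the residual inequality; (2) the
«`s` smallest elements» of a finite set of naturals form a kept-point selector with `#J X = min #X s` and heredity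
(`card_smallest`, `smallest_hereditary`); (3) the count of valid pairs with a condition on the part sizes is
`Σ_{i₁,i₂} C(k₁,i₁)C(k₂,i₂)·[P i₁ i₂]·C(f₁+f₂, δ)` (`card_filter_valid_eq_sum`, through `card_pairs_subsets`:
the pairs of subsets of sizes summing to `δ` number `C(#A+#B, δ)`).  Hence `pld_arith`: for `Θ ≤ lo+hi+δ` with `lo = 0`
or `Θ = lo+hi+δ`, `c_l = min(i_l, s_l)`, `f_l = min(k_l − i_l, s_l)`,
  `Σ_{i₁,i₂} C(k₁,i₁)C(k₂,i₂)·[lo ≤ c₁+c₂ ≤ hi ∧ Θ ≤ f₁+f₂+c₁+c₂]·C(f₁+f₂, δ)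
     ≤ Σ_{i₁,i₂} C(k₁,i₁)C(k₂,i₂)·[lo+δ ≤ f₁+f₂ ≤ hi+δ]·C(f₁+f₂, δ)`
— the per-layer dominance (PLD) of `U_{s₁,k₁} ⊕ U_{s₂,k₂}`, which by the layer-cake lemma gives every row `(q, u)` of
`U_{s₁,k₁} ⊕ U_{s₂,k₂} ⊕ U_{m,m}` (`C025ProfileTwoFlatTF`).  No `def`, no `instance`, no notation.  Axioms: standard.
-/

namespace PercRepro

namespace TwoFlatPLD

open Finset

/-- The «`s` smallest elements» of a finite set of naturals: those with fewer than `s` smaller elements in the set. -/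
theorem smallest_subset (s : ℕ) (X : Finset ℕ) :
    X.filter (fun x => (X.filter (fun y => y < x)).card < s) ⊆ X := filter_subset _ _

/-- Heredity of the smallest elements: `X' ⊆ X → J X ∩ X' ⊆ J X'`. -/
theorem smallest_hereditary (s : ℕ) (X X' : Finset ℕ) (h : X' ⊆ X) :
    X.filter (fun x => (X.filter (fun y => y < x)).card < s) ∩ X' ⊆
      X'.filter (fun x => (X'.filter (fun y => y < x)).card < s) := by
  intro x hx
  rw [mem_inter, mem_filter] at hx
  rw [mem_filter]
  refine ⟨hx.2, lt_of_le_of_lt ?_ hx.1.2⟩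
  exact card_le_card (filter_subset_filter _ h)

/-- The smallest elements number `min #X s`. -/
theorem card_smallest (s : ℕ) (X : Finset ℕ) :
    (X.filter (fun x => (X.filter (fun y => y < x)).card < s)).card = min X.card s := by
  induction X using Finset.induction_on_max with
  | empty => simp
  | insert a X' hlt ih =>
    have ha : a ∉ X' := fun h => lt_irrefl a (hlt a h)
    -- the lower sets in `insert a X'`
    have hbelow : ∀ x ∈ X', (insert a X').filter (fun y => y < x) = X'.filter (fun y => y < x) := by
      intro x hx
      ext y
      simp only [mem_filter, mem_insert]
      constructor
      · rintro ⟨hy | hy, hyx⟩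
        · subst hy; exact absurd (lt_trans hyx (hlt x hx)) (lt_irrefl _)
        · exact ⟨hy, hyx⟩
      · rintro ⟨hy, hyx⟩
        exact ⟨Or.inr hy, hyx⟩
    have hbelow_a : (insert a X').filter (fun y => y < a) = X' := by
      ext y
      simp only [mem_filter, mem_insert]
      constructor
      · rintro ⟨hy | hy, hya⟩
        · subst hy; exact absurd hya (lt_irrefl _)
        · exact hy
      · intro hy
        exact ⟨Or.inr hy, hlt y hy⟩
    rw [filter_insert, hbelow_a]
    have hfilt : X'.filter (fun x => ((insert a X').filter (fun y => y < x)).card < s) =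
        X'.filter (fun x => (X'.filter (fun y => y < x)).card < s) := by
      apply filter_congr
      intro x hx
      rw [hbelow x hx]
    rw [hfilt]
    rw [card_insert_of_notMem ha]
    split_ifs with hs
    · rw [card_insert_of_notMem (fun h => ha (filter_subset _ _ h)), ih]
      omega
    · rw [ih]
      omega

section Count
variable {α β : Type} [DecidableEq α] [DecidableEq β]

/-- **Per-layer dominance in source coordinates**, two uniform flats: for `Θ ≤ lo + hi + δ` with `lo = 0` or
`Θ = lo + hi + δ`, the pairs `(I, D)` with `lo ≤ ρ(I) ≤ hi` and `Θ ≤ ρ(E ∖ I) + ρ(I)` are at most the pairs with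
`lo + δ ≤ ρ(E ∖ I) ≤ hi + δ` (`#D = δ` throughout): the pairs with `ρ(E ∖ I) ≤ hi + δ` are their own slots and the
residual ones inject into `THI` by `card_RS_le_card_THI`. -/
theorem card_sources_le_card_T
    (F₁ : Finset α) (F₂ : Finset β) (s₁ s₂ : ℕ) (J₁ : Finset α → Finset α) (J₂ : Finset β → Finset β)
    (hJ₁ : ∀ X, J₁ X ⊆ X) (hc₁ : ∀ X, (J₁ X).card = min X.card s₁)
    (hh₁ : ∀ X X', X' ⊆ X → J₁ X ∩ X' ⊆ J₁ X')
    (hJ₂ : ∀ X, J₂ X ⊆ X) (hc₂ : ∀ X, (J₂ X).card = min X.card s₂)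
    (hh₂ : ∀ X X', X' ⊆ X → J₂ X ∩ X' ⊆ J₂ X')
    (lo hi δ Θ : ℕ) (hΘ : Θ ≤ lo + hi + δ) (hlo : lo = 0 ∨ lo + hi + δ ≤ Θ) :
    (((F₁.powerset ×ˢ F₁.powerset) ×ˢ (F₂.powerset ×ˢ F₂.powerset)).filter
      (fun σ : (Finset α × Finset α) × (Finset β × Finset β) =>
        σ.1.2 ⊆ J₁ (F₁ \ σ.1.1) ∧ σ.2.2 ⊆ J₂ (F₂ \ σ.2.1) ∧ σ.1.2.card + σ.2.2.card = δ ∧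
        lo ≤ min σ.1.1.card s₁ + min σ.2.1.card s₂ ∧ min σ.1.1.card s₁ + min σ.2.1.card s₂ ≤ hi ∧
        Θ ≤ min (F₁.card - σ.1.1.card) s₁ + min (F₂.card - σ.2.1.card) s₂ +
          (min σ.1.1.card s₁ + min σ.2.1.card s₂))).card ≤
    (((F₁.powerset ×ˢ F₁.powerset) ×ˢ (F₂.powerset ×ˢ F₂.powerset)).filter
      (fun σ : (Finset α × Finset α) × (Finset β × Finset β) =>
        σ.1.2 ⊆ J₁ (F₁ \ σ.1.1) ∧ σ.2.2 ⊆ J₂ (F₂ \ σ.2.1) ∧ σ.1.2.card + σ.2.2.card = δ ∧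
        lo + δ ≤ min (F₁.card - σ.1.1.card) s₁ + min (F₂.card - σ.2.1.card) s₂ ∧
        min (F₁.card - σ.1.1.card) s₁ + min (F₂.card - σ.2.1.card) s₂ ≤ hi + δ)).card := by
  classical
  set U := (F₁.powerset ×ˢ F₁.powerset) ×ˢ (F₂.powerset ×ˢ F₂.powerset) with hU
  -- membership in `U` from the kept-point conditions
  have memU : ∀ σ : (Finset α × Finset α) × (Finset β × Finset β), σ ∈ U ↔
      σ.1.1 ⊆ F₁ ∧ σ.1.2 ⊆ F₁ ∧ σ.2.1 ⊆ F₂ ∧ σ.2.2 ⊆ F₂ := by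
    intro σ
    simp only [hU, mem_product, mem_powerset]
    tauto
  have hDF₁ : ∀ σ : (Finset α × Finset α) × (Finset β × Finset β), σ.1.2 ⊆ J₁ (F₁ \ σ.1.1) → σ.1.2 ⊆ F₁ :=
    fun σ h => h.trans ((hJ₁ _).trans sdiff_subset)
  have hDF₂ : ∀ σ : (Finset α × Finset α) × (Finset β × Finset β), σ.2.2 ⊆ J₂ (F₂ \ σ.2.1) → σ.2.2 ⊆ F₂ :=
    fun σ h => h.trans ((hJ₂ _).trans sdiff_subset)
  -- `δ ≤ f` for every valid pair
  have hδf : ∀ σ : (Finset α × Finset α) × (Finset β × Finset β), σ.1.1 ⊆ F₁ → σ.2.1 ⊆ F₂ →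
      σ.1.2 ⊆ J₁ (F₁ \ σ.1.1) → σ.2.2 ⊆ J₂ (F₂ \ σ.2.1) →
      σ.1.2.card + σ.2.2.card ≤ min (F₁.card - σ.1.1.card) s₁ + min (F₂.card - σ.2.1.card) s₂ := by
    intro σ h1 h2 hD1 hD2
    have a1 := card_le_card hD1
    have a2 := card_le_card hD2
    rw [hc₁, card_sdiff_of_subset h1] at a1
    rw [hc₂, card_sdiff_of_subset h2] at a2
    omega
  set RS := U.filter (fun σ : (Finset α × Finset α) × (Finset β × Finset β) =>
      σ.1.2 ⊆ J₁ (F₁ \ σ.1.1) ∧ σ.2.2 ⊆ J₂ (F₂ \ σ.2.1) ∧ σ.1.2.card + σ.2.2.card = δ ∧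
      lo ≤ min σ.1.1.card s₁ + min σ.2.1.card s₂ ∧ min σ.1.1.card s₁ + min σ.2.1.card s₂ ≤ hi ∧
      hi + δ + 1 ≤ min (F₁.card - σ.1.1.card) s₁ + min (F₂.card - σ.2.1.card) s₂) with hRSdef
  set THI := U.filter (fun σ : (Finset α × Finset α) × (Finset β × Finset β) =>
      σ.1.2 ⊆ J₁ (F₁ \ σ.1.1) ∧ σ.2.2 ⊆ J₂ (F₂ \ σ.2.1) ∧ σ.1.2.card + σ.2.2.card = δ ∧
      lo + δ ≤ min (F₁.card - σ.1.1.card) s₁ + min (F₂.card - σ.2.1.card) s₂ ∧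
      min (F₁.card - σ.1.1.card) s₁ + min (F₂.card - σ.2.1.card) s₂ ≤ hi + δ ∧
      hi + 1 ≤ min σ.1.1.card s₁ + min σ.2.1.card s₂) with hTHIdef
  have hRS : ∀ σ : (Finset α × Finset α) × (Finset β × Finset β), σ ∈ RS ↔
      σ.1.1 ⊆ F₁ ∧ σ.2.1 ⊆ F₂ ∧ σ.1.2 ⊆ J₁ (F₁ \ σ.1.1) ∧ σ.2.2 ⊆ J₂ (F₂ \ σ.2.1) ∧
      σ.1.2.card + σ.2.2.card = δ ∧ lo ≤ min σ.1.1.card s₁ + min σ.2.1.card s₂ ∧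
      min σ.1.1.card s₁ + min σ.2.1.card s₂ ≤ hi ∧
      hi + δ + 1 ≤ min (F₁.card - σ.1.1.card) s₁ + min (F₂.card - σ.2.1.card) s₂ := by
    intro σ
    rw [hRSdef, mem_filter, memU]
    constructor
    · rintro ⟨⟨a1, -, a3, -⟩, b1, b2, b3, b4, b5, b6⟩
      exact ⟨a1, a3, b1, b2, b3, b4, b5, b6⟩
    · rintro ⟨a1, a3, b1, b2, b3, b4, b5, b6⟩
      exact ⟨⟨a1, hDF₁ σ b1, a3, hDF₂ σ b2⟩, b1, b2, b3, b4, b5, b6⟩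
  have hTHI : ∀ σ : (Finset α × Finset α) × (Finset β × Finset β), σ ∈ THI ↔
      σ.1.1 ⊆ F₁ ∧ σ.2.1 ⊆ F₂ ∧ σ.1.2 ⊆ J₁ (F₁ \ σ.1.1) ∧ σ.2.2 ⊆ J₂ (F₂ \ σ.2.1) ∧
      σ.1.2.card + σ.2.2.card = δ ∧
      lo + δ ≤ min (F₁.card - σ.1.1.card) s₁ + min (F₂.card - σ.2.1.card) s₂ ∧
      min (F₁.card - σ.1.1.card) s₁ + min (F₂.card - σ.2.1.card) s₂ ≤ hi + δ ∧
      hi + 1 ≤ min σ.1.1.card s₁ + min σ.2.1.card s₂ := by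
    intro σ
    rw [hTHIdef, mem_filter, memU]
    constructor
    · rintro ⟨⟨a1, -, a3, -⟩, b1, b2, b3, b4, b5, b6⟩
      exact ⟨a1, a3, b1, b2, b3, b4, b5, b6⟩
    · rintro ⟨a1, a3, b1, b2, b3, b4, b5, b6⟩
      exact ⟨⟨a1, hDF₁ σ b1, a3, hDF₂ σ b2⟩, b1, b2, b3, b4, b5, b6⟩
  have hcore := card_RS_le_card_THI F₁ F₂ s₁ s₂ J₁ J₂ hJ₁ hc₁ hh₁ hJ₂ hc₂ hh₂ lo hi δ RS THI hRS hTHI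
  -- the low sources are slots with `x ≤ hi`; the residual sources are `RS`
  set T := U.filter (fun σ : (Finset α × Finset α) × (Finset β × Finset β) =>
      σ.1.2 ⊆ J₁ (F₁ \ σ.1.1) ∧ σ.2.2 ⊆ J₂ (F₂ \ σ.2.1) ∧ σ.1.2.card + σ.2.2.card = δ ∧
      lo + δ ≤ min (F₁.card - σ.1.1.card) s₁ + min (F₂.card - σ.2.1.card) s₂ ∧
      min (F₁.card - σ.1.1.card) s₁ + min (F₂.card - σ.2.1.card) s₂ ≤ hi + δ) with hTdef
  set Tlow := T.filter (fun σ : (Finset α × Finset α) × (Finset β × Finset β) =>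
      min σ.1.1.card s₁ + min σ.2.1.card s₂ ≤ hi) with hTlowdef
  have hsub : (U.filter (fun σ : (Finset α × Finset α) × (Finset β × Finset β) =>
        σ.1.2 ⊆ J₁ (F₁ \ σ.1.1) ∧ σ.2.2 ⊆ J₂ (F₂ \ σ.2.1) ∧ σ.1.2.card + σ.2.2.card = δ ∧
        lo ≤ min σ.1.1.card s₁ + min σ.2.1.card s₂ ∧ min σ.1.1.card s₁ + min σ.2.1.card s₂ ≤ hi ∧
        Θ ≤ min (F₁.card - σ.1.1.card) s₁ + min (F₂.card - σ.2.1.card) s₂ +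
          (min σ.1.1.card s₁ + min σ.2.1.card s₂))) ⊆ Tlow ∪ RS := by
    intro σ hσ
    rw [mem_filter] at hσ
    obtain ⟨hσU, b1, b2, b3, b4, b5, b6⟩ := hσ
    have hU' := (memU σ).1 hσU
    have hδf' := hδf σ hU'.1 hU'.2.2.1 b1 b2
    rw [mem_union]
    by_cases hf : min (F₁.card - σ.1.1.card) s₁ + min (F₂.card - σ.2.1.card) s₂ ≤ hi + δ
    · left
      rw [hTlowdef, mem_filter, hTdef, mem_filter]
      refine ⟨⟨hσU, b1, b2, b3, ?_, hf⟩, b5⟩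
      rcases hlo with h0 | h0
      · omega
      · omega
    · right
      rw [hRSdef, mem_filter]
      exact ⟨hσU, b1, b2, b3, b4, b5, by omega⟩
  have hdisj : Disjoint Tlow THI := by
    rw [disjoint_left]
    intro σ h1 h2
    rw [hTlowdef, mem_filter] at h1
    rw [hTHIdef, mem_filter] at h2
    omega
  have hTHIsub : THI ⊆ T := by
    intro σ h
    rw [hTHIdef, mem_filter] at h
    rw [hTdef, mem_filter]
    exact ⟨h.1, h.2.1, h.2.2.1, h.2.2.2.1, h.2.2.2.2.1, h.2.2.2.2.2.1⟩
  calc _ ≤ (Tlow ∪ RS).card := card_le_card hsub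
    _ ≤ Tlow.card + RS.card := card_union_le _ _
    _ ≤ Tlow.card + THI.card := by omega
    _ = (Tlow ∪ THI).card := (card_union_of_disjoint hdisj).symm
    _ ≤ T.card := card_le_card (union_subset (filter_subset _ _) hTHIsub)
end Count

section Counting
variable {α β : Type} [DecidableEq α] [DecidableEq β]

omit [DecidableEq α] [DecidableEq β] in
/-- The pairs `(D₁, D₂)` with `D₁ ⊆ A`, `D₂ ⊆ B`, `#D₁ + #D₂ = δ` number `C(#A + #B, δ)`. -/
theorem card_pairs_subsets (A : Finset α) (B : Finset β) (δ : ℕ) :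
    ((A.powerset ×ˢ B.powerset).filter (fun D : Finset α × Finset β => D.1.card + D.2.card = δ)).card =
      (A.card + B.card).choose δ := by
  rw [card_filter, sum_product]
  -- inner: for fixed `D₁`, the `D₂ ⊆ B` with `#D₂ = δ − #D₁` (and `#D₁ ≤ δ`)
  have hinner : ∀ D₁ ∈ A.powerset,
      (∑ D₂ ∈ B.powerset, if D₁.card + D₂.card = δ then 1 else 0) =
        (fun d => if d ≤ δ then B.card.choose (δ - d) else 0) D₁.card := by
    intro D₁ _
    simp only
    split_ifs with hd
    · rw [← card_filter]
      have : B.powerset.filter (fun D₂ => D₁.card + D₂.card = δ) = B.powersetCard (δ - D₁.card) := by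
        ext D₂
        simp only [mem_filter, mem_powerset, mem_powersetCard]
        constructor
        · rintro ⟨h1, h2⟩; exact ⟨h1, by omega⟩
        · rintro ⟨h1, h2⟩; exact ⟨h1, by omega⟩
      rw [this, card_powersetCard]
    · apply sum_eq_zero
      intro D₂ _
      rw [if_neg]
      omega
  rw [sum_congr rfl hinner, sum_powerset_apply_card (fun d => if d ≤ δ then B.card.choose (δ - d) else 0)]
  simp only [smul_eq_mul]
  have h1 : (∑ d ∈ range (A.card + 1), A.card.choose d * (if d ≤ δ then B.card.choose (δ - d) else 0)) =
      ∑ d ∈ range (A.card + 1), (if d ≤ δ then A.card.choose d * B.card.choose (δ - d) else 0) := by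
    apply sum_congr rfl
    intro d _
    split_ifs <;> simp
  rw [h1, OneFlat.sum_range_ite_le_eq A.card δ (fun d => A.card.choose d * B.card.choose (δ - d))
    (fun d hd => by rw [Nat.choose_eq_zero_of_lt hd, zero_mul])]
  rw [Nat.add_choose_eq, Finset.Nat.sum_antidiagonal_eq_sum_range_succ
    (fun i j => A.card.choose i * B.card.choose j)]
end Counting

section Counting2
variable {α β : Type} [DecidableEq α] [DecidableEq β]

/-- The inner count: `D₁ ⊆ A ⊆ F₁`, `D₂ ⊆ B ⊆ F₂`, `#D₁ + #D₂ = δ`, under a condition `c`. -/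
theorem sum_pairs_eq (F₁ A : Finset α) (F₂ B : Finset β) (hA : A ⊆ F₁) (hB : B ⊆ F₂) (δ : ℕ)
    (c : Prop) [Decidable c] :
    (∑ D₁ ∈ F₁.powerset, ∑ D₂ ∈ F₂.powerset,
        (if D₁ ⊆ A ∧ D₂ ⊆ B ∧ D₁.card + D₂.card = δ ∧ c then 1 else 0)) =
      if c then (A.card + B.card).choose δ else 0 := by
  by_cases hc : c
  · rw [if_pos hc, ← card_pairs_subsets A B δ, card_filter, sum_product]
    rw [← sum_subset (powerset_mono.2 hA)]
    · apply sum_congr rfl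
      intro D₁ hD₁
      rw [mem_powerset] at hD₁
      rw [← sum_subset (powerset_mono.2 hB)]
      · apply sum_congr rfl
        intro D₂ hD₂
        rw [mem_powerset] at hD₂
        simp only [hD₁, hD₂, hc, true_and, and_true]
      · intro D₂ _ hD₂
        rw [mem_powerset] at hD₂
        simp only [hD₂, false_and, and_false, if_false]
    · intro D₁ _ hD₁
      rw [mem_powerset] at hD₁
      apply sum_eq_zero
      intro D₂ _
      simp only [hD₁, false_and, if_false]
  · rw [if_neg hc]
    apply sum_eq_zero
    intro D₁ _
    apply sum_eq_zero
    intro D₂ _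
    simp only [hc, and_false, if_false]

/-- **The count of valid pairs with a condition on the part sizes**: the pairs `(I, D)` of the two-flat model with
`#D = δ` and `P #I₁ #I₂` number `Σ_{i₁ ≤ k₁} Σ_{i₂ ≤ k₂} C(k₁,i₁)C(k₂,i₂)·[P i₁ i₂]·C(min(k₁−i₁,s₁)+min(k₂−i₂,s₂), δ)`. -/
theorem card_filter_valid_eq_sum
    (F₁ : Finset α) (F₂ : Finset β) (s₁ s₂ : ℕ) (J₁ : Finset α → Finset α) (J₂ : Finset β → Finset β)
    (hJ₁ : ∀ X, J₁ X ⊆ X) (hc₁ : ∀ X, (J₁ X).card = min X.card s₁)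
    (hJ₂ : ∀ X, J₂ X ⊆ X) (hc₂ : ∀ X, (J₂ X).card = min X.card s₂)
    (δ : ℕ) (P : ℕ → ℕ → Prop) [DecidableRel P] :
    (((F₁.powerset ×ˢ F₁.powerset) ×ˢ (F₂.powerset ×ˢ F₂.powerset)).filter
      (fun σ : (Finset α × Finset α) × (Finset β × Finset β) =>
        σ.1.2 ⊆ J₁ (F₁ \ σ.1.1) ∧ σ.2.2 ⊆ J₂ (F₂ \ σ.2.1) ∧ σ.1.2.card + σ.2.2.card = δ ∧
          P σ.1.1.card σ.2.1.card)).card =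
    ∑ i₁ ∈ range (F₁.card + 1), ∑ i₂ ∈ range (F₂.card + 1),
      F₁.card.choose i₁ * F₂.card.choose i₂ *
        (if P i₁ i₂ then (min (F₁.card - i₁) s₁ + min (F₂.card - i₂) s₂).choose δ else 0) := by
  rw [card_filter, sum_product, sum_product]
  -- for each `I₁`: swap `D₁` with `I₂`, evaluate the inner pair count
  have hinner : ∀ I₁ ∈ F₁.powerset,
      (∑ D₁ ∈ F₁.powerset, ∑ y ∈ F₂.powerset ×ˢ F₂.powerset,
        (if ((I₁, D₁), y).1.2 ⊆ J₁ (F₁ \ ((I₁, D₁), y).1.1) ∧ ((I₁, D₁), y).2.2 ⊆ J₂ (F₂ \ ((I₁, D₁), y).2.1) ∧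
            ((I₁, D₁), y).1.2.card + ((I₁, D₁), y).2.2.card = δ ∧ P ((I₁, D₁), y).1.1.card ((I₁, D₁), y).2.1.card
          then 1 else 0)) =
      ∑ I₂ ∈ F₂.powerset, (fun i₂ => if P I₁.card i₂ then
          (min (F₁.card - I₁.card) s₁ + min (F₂.card - i₂) s₂).choose δ else 0) I₂.card := by
    intro I₁ hI₁
    rw [mem_powerset] at hI₁
    simp only [sum_product]
    rw [sum_comm]
    apply sum_congr rfl
    intro I₂ hI₂
    rw [mem_powerset] at hI₂
    have hA : J₁ (F₁ \ I₁) ⊆ F₁ := (hJ₁ _).trans sdiff_subset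
    have hB : J₂ (F₂ \ I₂) ⊆ F₂ := (hJ₂ _).trans sdiff_subset
    have key : (∑ D₁ ∈ F₁.powerset, ∑ D₂ ∈ F₂.powerset,
        (if D₁ ⊆ J₁ (F₁ \ I₁) ∧ D₂ ⊆ J₂ (F₂ \ I₂) ∧ D₁.card + D₂.card = δ ∧ P I₁.card I₂.card then 1 else 0)) =
        if P I₁.card I₂.card then ((J₁ (F₁ \ I₁)).card + (J₂ (F₂ \ I₂)).card).choose δ else 0 :=
      sum_pairs_eq F₁ (J₁ (F₁ \ I₁)) F₂ (J₂ (F₂ \ I₂)) hA hB δ (P I₁.card I₂.card)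
    rw [hc₁, hc₂, card_sdiff_of_subset hI₁, card_sdiff_of_subset hI₂] at key
    exact key
  rw [sum_congr rfl hinner]
  -- the outer sums by the sizes
  have houter : ∀ I₁ ∈ F₁.powerset,
      (∑ I₂ ∈ F₂.powerset, (fun i₂ => if P I₁.card i₂ then
          (min (F₁.card - I₁.card) s₁ + min (F₂.card - i₂) s₂).choose δ else 0) I₂.card) =
      (fun i₁ => ∑ i₂ ∈ range (F₂.card + 1), F₂.card.choose i₂ *
        (if P i₁ i₂ then (min (F₁.card - i₁) s₁ + min (F₂.card - i₂) s₂).choose δ else 0)) I₁.card := by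
    intro I₁ _
    rw [sum_powerset_apply_card (fun i₂ => if P I₁.card i₂ then
          (min (F₁.card - I₁.card) s₁ + min (F₂.card - i₂) s₂).choose δ else 0)]
    simp only [smul_eq_mul]
  rw [sum_congr rfl houter, sum_powerset_apply_card (fun i₁ => ∑ i₂ ∈ range (F₂.card + 1), F₂.card.choose i₂ *
        (if P i₁ i₂ then (min (F₁.card - i₁) s₁ + min (F₂.card - i₂) s₂).choose δ else 0))]
  simp only [smul_eq_mul]
  apply sum_congr rfl
  intro i₁ _
  rw [mul_sum]
  apply sum_congr rfl
  intro i₂ _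
  ring
end Counting2

section Arith
/-- **PER-LAYER DOMINANCE ON TWO UNIFORM FLATS, ARITHMETIC FORM**: for `Θ ≤ lo + hi + δ` with `lo = 0` or
`Θ = lo + hi + δ`, with `c_l = min(i_l, s_l)`, `f_l = min(k_l − i_l, s_l)`,
  `Σ_{i₁ ≤ k₁, i₂ ≤ k₂} C(k₁,i₁)C(k₂,i₂)·[lo ≤ c₁+c₂ ≤ hi ∧ Θ ≤ f₁+f₂+c₁+c₂]·C(f₁+f₂, δ)
     ≤ Σ_{i₁ ≤ k₁, i₂ ≤ k₂} C(k₁,i₁)C(k₂,i₂)·[lo+δ ≤ f₁+f₂ ≤ hi+δ]·C(f₁+f₂, δ)`. -/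
theorem pld_arith (k₁ s₁ k₂ s₂ lo hi δ Θ : ℕ) (hΘ : Θ ≤ lo + hi + δ) (hlo : lo = 0 ∨ lo + hi + δ ≤ Θ) :
    (∑ i₁ ∈ range (k₁ + 1), ∑ i₂ ∈ range (k₂ + 1), k₁.choose i₁ * k₂.choose i₂ *
      (if lo ≤ min i₁ s₁ + min i₂ s₂ ∧ min i₁ s₁ + min i₂ s₂ ≤ hi ∧
          Θ ≤ min (k₁ - i₁) s₁ + min (k₂ - i₂) s₂ + (min i₁ s₁ + min i₂ s₂) then
        (min (k₁ - i₁) s₁ + min (k₂ - i₂) s₂).choose δ else 0)) ≤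
    ∑ i₁ ∈ range (k₁ + 1), ∑ i₂ ∈ range (k₂ + 1), k₁.choose i₁ * k₂.choose i₂ *
      (if lo + δ ≤ min (k₁ - i₁) s₁ + min (k₂ - i₂) s₂ ∧ min (k₁ - i₁) s₁ + min (k₂ - i₂) s₂ ≤ hi + δ then
        (min (k₁ - i₁) s₁ + min (k₂ - i₂) s₂).choose δ else 0) := by
  classical
  -- the model: `F₁ = range k₁`, `F₂ = range k₂`, the smallest-elements selectors
  have hJ₁ : ∀ X : Finset ℕ, X.filter (fun x => (X.filter (fun y => y < x)).card < s₁) ⊆ X :=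
    fun X => smallest_subset s₁ X
  have hc₁ : ∀ X : Finset ℕ, (X.filter (fun x => (X.filter (fun y => y < x)).card < s₁)).card = min X.card s₁ :=
    fun X => card_smallest s₁ X
  have hh₁ : ∀ X X' : Finset ℕ, X' ⊆ X →
      X.filter (fun x => (X.filter (fun y => y < x)).card < s₁) ∩ X' ⊆
        X'.filter (fun x => (X'.filter (fun y => y < x)).card < s₁) :=
    fun X X' h => smallest_hereditary s₁ X X' h
  have hJ₂ : ∀ X : Finset ℕ, X.filter (fun x => (X.filter (fun y => y < x)).card < s₂) ⊆ X :=
    fun X => smallest_subset s₂ X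
  have hc₂ : ∀ X : Finset ℕ, (X.filter (fun x => (X.filter (fun y => y < x)).card < s₂)).card = min X.card s₂ :=
    fun X => card_smallest s₂ X
  have hh₂ : ∀ X X' : Finset ℕ, X' ⊆ X →
      X.filter (fun x => (X.filter (fun y => y < x)).card < s₂) ∩ X' ⊆
        X'.filter (fun x => (X'.filter (fun y => y < x)).card < s₂) :=
    fun X X' h => smallest_hereditary s₂ X X' h
  have h := card_sources_le_card_T (range k₁) (range k₂) s₁ s₂ _ _ hJ₁ hc₁ hh₁ hJ₂ hc₂ hh₂ lo hi δ Θ hΘ hlo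
  have e1 := card_filter_valid_eq_sum (range k₁) (range k₂) s₁ s₂ _ _ hJ₁ hc₁ hJ₂ hc₂ δ
    (fun i₁ i₂ => lo ≤ min i₁ s₁ + min i₂ s₂ ∧ min i₁ s₁ + min i₂ s₂ ≤ hi ∧
      Θ ≤ min ((range k₁).card - i₁) s₁ + min ((range k₂).card - i₂) s₂ + (min i₁ s₁ + min i₂ s₂))
  have e2 := card_filter_valid_eq_sum (range k₁) (range k₂) s₁ s₂ _ _ hJ₁ hc₁ hJ₂ hc₂ δ
    (fun i₁ i₂ => lo + δ ≤ min ((range k₁).card - i₁) s₁ + min ((range k₂).card - i₂) s₂ ∧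
      min ((range k₁).card - i₁) s₁ + min ((range k₂).card - i₂) s₂ ≤ hi + δ)
  simp only [card_range] at h e1 e2
  rw [e1, e2] at h
  exact h
end Arith

end TwoFlatPLD
end PercRepro
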